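import Summits.Ventures.MM22.Rank333.GF2ProfileSymmetry
import Summits.Ventures.MM22.Rank333.GF2ProfileRowsSub
import Summits.Ventures.MM22.Rank333.Root21Kernel
import Summits.MatrixMultiplication.OmegaCensus.SmallFormats.RankRowIncrement
import Summits.MatrixMultiplication.OmegaCensus.SmallFormats.GF2Rank233Cert
import Literature.Computability.AlgebraicComplexity.HopcroftKerrRowLemma
import HarnessLib

/-!
# MM22 venture — TYPED SKELETON for «R_𝔽₂(⟨3,3,3⟩) ≥ 22 from a profile census» (W5 kernel endgame)

HONEST FRAMING (cell `pub-mm22`, seat p3 g5; lead g5 task 2026-08-23T08:14:50Z (ii)). This file proves NO bound.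
It fixes, in the tree's vocabulary (`Cert`, `BilinComp`, `Represents`, `profileOf`, `ValidAll`/`RowsOK`, `pullB`/`pullTB`),
the exact shape of the kernel object a successful W5 census would have to supply, and proves the REDUCTION without
`sorry`, so that the census enters as hypotheses:

* `hcomplete` — COMPLETENESS of the class list `L`: every profile of 21 nonzero 9-bit patterns that is valid against
  the cited certified rows (the table W ∪ lifts, every row a kernel `Cert 3 3 3 M b` read as a LOWER bound) is related,
  by the quotient relation used, to a listed class;
* `hnone` — every listed class is UNREALIZABLE (no 21-product `𝔽₂` computation of `⟨3,3,3⟩` is represented by it);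
* `hinv` — realizability is invariant under the quotient relation. For the concrete relation `GEquiv` below
  (re-indexing of the products and Wang's sandwich / transposed-sandwich moves on patterns, with bit-matrix inverse
  witnesses exactly as in the tree's S-node glue) this is PROVED here (`realizable_of_gEquiv`), so the `G`-form
  `rankGe22_of_census_G` has only `hcomplete` and `hnone` left.

Non-hypothesis ingredient: the cell's kernel theorem `twentyone_le_tensorRank_matMulTensor_three_F2` (K2), read back
as `Cert 3 3 3 [] 21` through the converse bridge `cert_nil_of_le_tensorRank`.

Section HK7 discharges `hnone` BY LEMMA for every class that is `GEquiv`-related to a profile with `≥ 5` patterns in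
one coordinate row or column of the `3 × 3` layout (`not_realizable21_of_gEquiv_hk7`; Hopcroft–Kerr 1971 Lemma 7 =
tree `HopcroftKerrRow.hopcroftKerr1971_lemma7_row/col`, with `R_𝔽₂(⟨2,3,3⟩) = 15` = tree
`Cert233.le_tensorRank_matMulTensor_233_gf2`): `15 + 3 + k ≤ 21 + ⌊k/3⌋ ⇒ k ≤ 4`. No summit claim; nothing here is
evidence that the census hypotheses hold.
-/

namespace Summit.Ventures.MM22.Census22

open Summit.MatrixMultiplication.OmegaCensus.GF2RankLB
open Summit.MatrixMultiplication.OmegaCensus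
open Summit.Ventures.MM22.GF2Cert.Profile
open Literature.Computability.AlgebraicComplexity

/-! ## Generic layer: format `⟨l,m,n⟩` over `𝔽₂`, `N` products -/

section Generic

variable {l m n N : ℕ}

/-- **Realizability of a profile**: some `N`-product bilinear computation of `ψ_[] = ⟨l,m,n⟩` over `𝔽₂` is
REPRESENTED by `prof` (its `i`-th first form is the form of the pattern `prof i`; tree `Represents`). -/
def Realizable (l m n N : ℕ) (prof : Fin N → ℕ) : Prop :=
  ∃ β : BilinComp (psiK l m n []) (Fin N), Represents β prof

/-- A realizable profile is valid against every certified row (tree `validAllSub_of_represents` at `K = []`). -/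
theorem validAll_of_realizable {prof : Fin N → ℕ} (h : Realizable l m n N prof) : ValidAll l m n N prof := by
  obtain ⟨β, hβ⟩ := h
  exact (validAllSub_nil_iff prof).1 (validAllSub_of_represents β hβ)

/-- The profile of a computation of `ψ_[]` represents it. -/
theorem represents_profileOf_ofNil (β : BilinComp (psiK l m n []) (Fin N)) : Represents β (profileOf (ofNil β)) := by
  intro i u
  rw [form_profileOf, ofNil_f]
  congr 1

/-- **Invariance 1 — re-indexing the products.** -/
theorem realizable_comp_equiv {prof : Fin N → ℕ} (h : Realizable l m n N prof) (e : Equiv.Perm (Fin N)) :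
    Realizable l m n N (prof ∘ e) := by
  obtain ⟨β, hβ⟩ := h
  exact ⟨β.reindex e, fun i u => hβ (e i) u⟩

/-- **Invariance 2 — the sandwich `X ↦ P X Q`** (bit matrices with inverse witnesses `Pi P = 1`, `Q Qi = 1`, the
conventions of `validAll_comp_pullB`): the transported computation (`BilinComp.ofSandwichLE`, Wang 2026 Lemma 1)
is represented by `pullB l m P Q ∘ prof` (`form_sandwich`). -/
theorem realizable_pullB {P Pi Q Qi : ℕ} (hP : mulBits l l l Pi P = oneBits l) (hQ : mulBits m m m Q Qi = oneBits m)
    {prof : Fin N → ℕ} (h : Realizable l m n N prof) : Realizable l m n N (fun i => pullB l m P Q (prof i)) := by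
  obtain ⟨β, hβ⟩ := h
  refine ⟨β.ofSandwichLE (ofBits l l P) (ofBits l l Pi) (ofBits m m Q) (ofBits m m Qi)
    (ofBits_eq_one_of_mulBits_eq hP) (ofBits_eq_one_of_mulBits_eq hQ) (fun x _ => mem_subOf_nil _), fun i u => ?_⟩
  rw [BilinComp.ofSandwichLE_f, hβ i, ← form_sandwich]

/-- **Invariance 3 — the transposed sandwich `X ↦ P Xᵀ Q`** (square first factor; conventions of
`validAll_comp_pullTB`): represented by `pullTB l P Q ∘ prof` (`BilinComp.ofTransposeSandwichLE`, `form_sandwichT`). -/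
theorem realizable_pullTB {P Pi Q Qi : ℕ} (hP : mulBits l l l Pi P = oneBits l) (hQ : mulBits l l l Q Qi = oneBits l)
    {prof : Fin N → ℕ} (h : Realizable l l n N prof) : Realizable l l n N (fun i => pullTB l P Q (prof i)) := by
  obtain ⟨β, hβ⟩ := h
  refine ⟨β.ofTransposeSandwichLE (ofBits l l P) (ofBits l l Pi) (ofBits l l Q) (ofBits l l Qi)
    (ofBits_eq_one_of_mulBits_eq hP) (ofBits_eq_one_of_mulBits_eq hQ) (fun x _ => mem_subOf_nil _), fun i u => ?_⟩
  rw [BilinComp.ofTransposeSandwichLE_f, hβ i, ← form_sandwichT]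

/-- The converse bridge to `le_tensorRank_of_cert_nil`: `b ≤ R_𝔽₂(⟨l,m,n⟩)` gives `Cert l m n [] b`
(a computation of `ψ_[]` of length `r` is one of `⟨l,m,n⟩`, so `R ≤ r` by `RankRowIncrement.tensorRank_le_card`). -/
theorem cert_nil_of_le_tensorRank {b : ℕ} (h : b ≤ tensorRank (matMulTensor (ZMod 2) l m n)) : Cert l m n [] b := by
  intro r β
  have hr := RankRowIncrement.tensorRank_le_card (ofNil β)
  simp only [Fintype.card_fin] at hr
  omega

/-- **The core step: every valid profile unrealizable ⇒ one more product.** If every computation of `⟨l,m,n⟩`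
over `𝔽₂` needs `≥ N` products and NO profile of `N` nonzero patterns `< 2^(l m)` that is valid against every certified
row is realizable, then every computation needs `≥ N + 1` products. (The tree's `cert_succ_of_noValidAll` with «no
valid profile» weakened to «no REALIZABLE valid profile»; all census forms below are corollaries.) -/
theorem cert_succ_of_unrealizable (hN : Cert l m n [] N)
    (h : ∀ prof : Fin N → ℕ, (∀ i, prof i ≠ 0) → (∀ i, prof i < 2 ^ (l * m)) →
      ValidAll l m n N prof → ¬ Realizable l m n N prof) :
    Cert l m n [] (N + 1) := by
  classical
  intro r β
  have hNr : N ≤ r := hN r β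
  by_contra hlt
  have hrN : r = N := by omega
  subst hrN
  -- all first forms are nonzero, else dropping one contradicts `Cert [] r`
  have hnz : ∀ i, β.f i ≠ 0 := by
    intro i hi
    have hJ : ∀ j ∈ ({i} : Finset (Fin r)), ∀ u : subOf l m [],
        β.f j (Submodule.inclusion le_rfl u) = 0 := by
      intro j hj u
      rw [Finset.mem_singleton.1 hj, hi]
      rfl
    obtain ⟨γ⟩ := BilinComp.exists_restrictAlong β le_rfl {i} hJ
    have := hN _ γ
    simp only [Fintype.card_fin, Finset.card_singleton] at this
    have hpos : 0 < r := Fin.pos i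
    omega
  have hreal : Realizable l m n r (profileOf (ofNil β)) := ⟨β, represents_profileOf_ofNil β⟩
  have h0 : ∀ i, profileOf (ofNil β) i ≠ 0 := fun i => profileOf_ne_zero (ofNil β) i (by
    rw [Ne, ofNil_f_eq_zero_iff]; exact hnz i)
  exact h (profileOf (ofNil β)) h0 (fun i => profileOf_lt (ofNil β) i) (validAll_profileOf (ofNil β)) hreal

/-- **The census step, generic form (validity against EVERY certified row).** If every computation of `⟨l,m,n⟩`
over `𝔽₂` needs `≥ N` products, every profile of `N` nonzero patterns `< 2^(l m)` valid against every certified row is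
`R`-related to a listed class, every listed class is unrealizable, and realizability is `R`-invariant, then every
computation needs `≥ N + 1` products. -/
theorem cert_succ_of_census_validAll (hN : Cert l m n [] N)
    (R : (Fin N → ℕ) → (Fin N → ℕ) → Prop) (L : List (Fin N → ℕ))
    (hcomplete : ∀ prof : Fin N → ℕ, (∀ i, prof i ≠ 0) → (∀ i, prof i < 2 ^ (l * m)) →
      ValidAll l m n N prof → ∃ Q ∈ L, R prof Q)
    (hnone : ∀ Q ∈ L, ¬ Realizable l m n N Q)
    (hinv : ∀ P Q, R P Q → Realizable l m n N P → Realizable l m n N Q) :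
    Cert l m n [] (N + 1) :=
  cert_succ_of_unrealizable hN fun prof h0 hlt hval hreal => by
    obtain ⟨Q, hQ, hR⟩ := hcomplete prof h0 hlt hval
    exact hnone Q hQ (hinv _ _ hR hreal)

/-- **The census step against a CITED row list** (what a finite census replay proves): as above, with validity
against the listed certified rows (`RowsOK`) — a weaker validity notion, hence a stronger completeness hypothesis,
reduced to the `ValidAll` form by `ValidAll.rowsOK`. -/
theorem cert_succ_of_census (hN : Cert l m n [] N) (rows : List (List ℕ × ℕ))
    (hrows : ∀ r ∈ rows, Cert l m n r.1 r.2)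
    (R : (Fin N → ℕ) → (Fin N → ℕ) → Prop) (L : List (Fin N → ℕ))
    (hcomplete : ∀ prof : Fin N → ℕ, (∀ i, prof i ≠ 0) → (∀ i, prof i < 2 ^ (l * m)) →
      RowsOK N rows prof → ∃ Q ∈ L, R prof Q)
    (hnone : ∀ Q ∈ L, ¬ Realizable l m n N Q)
    (hinv : ∀ P Q, R P Q → Realizable l m n N P → Realizable l m n N Q) :
    Cert l m n [] (N + 1) :=
  cert_succ_of_census_validAll hN R L (fun prof h0 hlt hval => hcomplete prof h0 hlt (hval.rowsOK hrows))
    hnone hinv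

end Generic

/-! ## The quotient relation for square first factors: re-indexing + Wang's two pattern moves -/

section Square

variable {l n N : ℕ}

/-- One move of the intended quotient (square first factor `l × l`): re-index the products, or act on every pattern
by an invertible sandwich `pullB l l P Q` / transposed sandwich `pullTB l P Q` (bit matrices with inverse witnesses). -/
inductive GStep (l N : ℕ) : (Fin N → ℕ) → (Fin N → ℕ) → Prop
  | perm (prof : Fin N → ℕ) (e : Equiv.Perm (Fin N)) : GStep l N prof (prof ∘ e)
  | sandwich (prof : Fin N → ℕ) {P Pi Q Qi : ℕ} (hP : mulBits l l l Pi P = oneBits l)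
      (hQ : mulBits l l l Q Qi = oneBits l) : GStep l N prof (fun i => pullB l l P Q (prof i))
  | tsandwich (prof : Fin N → ℕ) {P Pi Q Qi : ℕ} (hP : mulBits l l l Pi P = oneBits l)
      (hQ : mulBits l l l Q Qi = oneBits l) : GStep l N prof (fun i => pullTB l P Q (prof i))

/-- **`GEquiv`**: the reflexive–transitive closure of the moves. -/
def GEquiv (l N : ℕ) : (Fin N → ℕ) → (Fin N → ℕ) → Prop := Relation.ReflTransGen (GStep l N)

/-- Realizability is preserved by one move. -/
theorem realizable_of_gStep {P Q : Fin N → ℕ} (h : GStep l N P Q) (hP : Realizable l l n N P) :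
    Realizable l l n N Q := by
  cases h with
  | perm e => exact realizable_comp_equiv hP e
  | sandwich hPm hQm => exact realizable_pullB hPm hQm hP
  | tsandwich hPm hQm => exact realizable_pullTB hPm hQm hP

/-- **`hinv` for `GEquiv`, proved**: realizability is `GEquiv`-invariant. -/
theorem realizable_of_gEquiv {P Q : Fin N → ℕ} (h : GEquiv l N P Q) (hP : Realizable l l n N P) :
    Realizable l l n N Q := by
  induction h with
  | refl => exact hP
  | tail _ hst ih => exact realizable_of_gStep hst ih

end Square

/-! ## The W5 instance: `⟨3,3,3⟩`, 21 products, rows = the cell's certified table -/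

section MM22

/-- **`Valid21 rows P`**: `P` is a profile of 21 NONZERO 9-bit patterns valid against the cited certified rows
(every row `(M, b)` of the census table — Wang ∪ lifts — read as the LOWER bound `Cert 3 3 3 M b`). -/
def Valid21 (rows : List (List ℕ × ℕ)) (P : Fin 21 → ℕ) : Prop :=
  (∀ i, P i ≠ 0) ∧ (∀ i, P i < 2 ^ 9) ∧ RowsOK 21 rows P

/-- **`Realizable21 P`**: some 21-product `𝔽₂` computation of `⟨3,3,3⟩` is represented by the profile `P`. -/
abbrev Realizable21 (P : Fin 21 → ℕ) : Prop := Realizable 3 3 3 21 P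

/-- `Cert 3 3 3 [] 21` — the kernel theorem K2 (`twentyone_le_tensorRank_matMulTensor_three_F2`) read back as
«every computation of `ψ_[] = ⟨3,3,3⟩` has `≥ 21` products». -/
theorem cert21 : Cert 3 3 3 [] 21 :=
  cert_nil_of_le_tensorRank twentyone_le_tensorRank_matMulTensor_three_F2

/-- Sanity: a realizable profile satisfies every cited certified row (the census quotient loses no computation). -/
theorem rowsOK_of_realizable21 {rows : List (List ℕ × ℕ)} (hrows : ∀ r ∈ rows, Cert 3 3 3 r.1 r.2)
    {P : Fin 21 → ℕ} (h : Realizable21 P) : RowsOK 21 rows P :=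
  (validAll_of_realizable h).rowsOK hrows

/-- **`R_𝔽₂(⟨3,3,3⟩) ≥ 22` if no valid 21-profile is realizable** (the core form; every census shape below and in
section HK7 is a way of establishing this hypothesis). -/
theorem rankGe22_of_unrealizable (rows : List (List ℕ × ℕ)) (hrows : ∀ r ∈ rows, Cert 3 3 3 r.1 r.2)
    (h : ∀ P, Valid21 rows P → ¬ Realizable21 P) :
    22 ≤ tensorRank (matMulTensor (ZMod 2) 3 3 3) :=
  le_tensorRank_of_cert_nil
    (cert_succ_of_unrealizable cert21 fun P h0 hlt hv =>
      h P ⟨h0, fun i => by simpa using hlt i, hv.rowsOK hrows⟩)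

/-- **`R_𝔽₂(⟨3,3,3⟩) ≥ 22` FROM A CENSUS, abstract quotient** (typed skeleton; the census is in the hypotheses).
`rows`/`hrows`: the census table as kernel `Cert`s; `L`: the class list; `R`: the quotient relation used;
`hcomplete`: completeness of `L` for `Valid21 rows`; `hnone`: every class unrealizable; `hinv`: realizability is
`R`-invariant. -/
theorem rankGe22_of_census (rows : List (List ℕ × ℕ)) (hrows : ∀ r ∈ rows, Cert 3 3 3 r.1 r.2)
    (R : (Fin 21 → ℕ) → (Fin 21 → ℕ) → Prop) (L : List (Fin 21 → ℕ))
    (hcomplete : ∀ P, Valid21 rows P → ∃ Q ∈ L, R P Q)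
    (hnone : ∀ Q ∈ L, ¬ Realizable21 Q)
    (hinv : ∀ P Q, R P Q → Realizable21 P → Realizable21 Q) :
    22 ≤ tensorRank (matMulTensor (ZMod 2) 3 3 3) :=
  le_tensorRank_of_cert_nil
    (cert_succ_of_census cert21 rows hrows R L
      (fun P h0 hlt hv => hcomplete P ⟨h0, fun i => by simpa using hlt i, hv⟩) hnone hinv)

/-- **`R_𝔽₂(⟨3,3,3⟩) ≥ 22` FROM A CENSUS modulo `GEquiv`** (re-indexing + Wang's sandwich/transposed-sandwich
moves): only completeness and unrealizability remain as hypotheses; invariance is `realizable_of_gEquiv`. -/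
theorem rankGe22_of_census_G (rows : List (List ℕ × ℕ)) (hrows : ∀ r ∈ rows, Cert 3 3 3 r.1 r.2)
    (L : List (Fin 21 → ℕ))
    (hcomplete : ∀ P, Valid21 rows P → ∃ Q ∈ L, GEquiv 3 21 P Q)
    (hnone : ∀ Q ∈ L, ¬ Realizable21 Q) :
    22 ≤ tensorRank (matMulTensor (ZMod 2) 3 3 3) :=
  rankGe22_of_census rows hrows (GEquiv 3 21) L hcomplete hnone (fun _ _ h hP => realizable_of_gEquiv h hP)

end MM22

/-! ## HK7: classes with ≥ 5 patterns in one coordinate row/column are unrealizable BY LEMMA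
(Hopcroft–Kerr 1971 Lemma 7, tree `hopcroftKerr1971_lemma7_row/col`, with `R_𝔽₂(⟨2,3,3⟩) = 15`,
tree `le_tensorRank_matMulTensor_233_gf2`: `15 + 3 + k ≤ 21 + ⌊k/3⌋ ⇒ k ≤ 4`), and — via `realizable_of_gEquiv` —
so is every class `GEquiv`-related to such a profile (any grid row/column under Wang's group). -/

section HK7

open Matrix

/-- The triad decomposition of `⟨c,m,n⟩` carried by a bilinear computation (`u_i = (f_i(E_b))_b`,
`v_i = (g_i(E_q))_q`, `w_i`); the identity inside `RankRowIncrement.tensorRank_le_card`, exposed. -/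
theorem matMulTensor_eq_sum_triad {c m n : ℕ} {ι : Type*} [Fintype ι]
    (β : BilinComp (mulBilin (ZMod 2) c m n) ι) :
    matMulTensor (ZMod 2) c m n = ∑ i, triad (fun a : Fin c × Fin n => β.w i a.1 a.2)
      (fun b : Fin c × Fin m => β.f i (Matrix.single b.1 b.2 1))
      (fun q : Fin m × Fin n => β.g i (Matrix.single q.1 q.2 1)) := by
  classical
  funext a b q
  have h := β.map_eq_sum (Matrix.single b.1 b.2 (1 : ZMod 2)) (Matrix.single q.1 q.2 (1 : ZMod 2))
  rw [mulBilin_apply] at h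
  have h' := congrFun (congrFun h a.1) a.2
  rw [Matrix.sum_apply] at h'
  simp only [Matrix.smul_apply, smul_eq_mul] at h'
  have lhs : (Matrix.single b.1 b.2 (1 : ZMod 2) * Matrix.single q.1 q.2 (1 : ZMod 2)) a.1 a.2 =
      matMulTensor (ZMod 2) c m n a b q := by
    simp only [matMulTensor]
    by_cases hbq : b.2 = q.1
    · rw [hbq, Matrix.single_mul_single_same, mul_one, Matrix.single_apply]
      by_cases h1 : a.1 = b.1 <;> by_cases h2 : a.2 = q.2 <;> simp [h1, h2, eq_comm]
    · rw [Matrix.single_mul_single_of_ne (h := hbq), Matrix.zero_apply]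
      simp [hbq]
  rw [← lhs, h']
  simp only [Finset.sum_apply, triad_apply]
  refine Finset.sum_congr rfl fun i _ => ?_
  ring

/-- A pattern form at a matrix unit: the bit at that position. -/
theorem form_single (l m κ : ℕ) (a : Fin l) (c : Fin m) :
    form l m κ (Matrix.single a c 1) = if κ.testBit (pos m a c) then 1 else 0 := by
  rw [form_apply, Finset.sum_eq_single a, Finset.sum_eq_single c]
  · simp
  · intro j _ hj
    simp [Ne.symm hj]
  · simp
  · intro i _ hi
    exact Finset.sum_eq_zero fun j _ => by simp [Ne.symm hi]
  · simp

/-- `P i` is supported in coordinate ROW `i₀` of the `3 × 3` layout (bit `pos 3 r c = c + 3 r`). -/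
def RowSupp (i₀ : Fin 3) (κ : ℕ) : Prop := ∀ b : Fin 3 × Fin 3, b.1 ≠ i₀ → κ.testBit (pos 3 b.1 b.2) = false

/-- `P i` is supported in coordinate COLUMN `j₀`. -/
def ColSupp (j₀ : Fin 3) (κ : ℕ) : Prop := ∀ b : Fin 3 × Fin 3, b.2 ≠ j₀ → κ.testBit (pos 3 b.1 b.2) = false

/-- `RowSupp` is decidable (finitely many bit tests). -/
instance (i₀ : Fin 3) (κ : ℕ) : Decidable (RowSupp i₀ κ) := by unfold RowSupp; infer_instance

/-- `ColSupp` is decidable (finitely many bit tests). -/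
instance (j₀ : Fin 3) (κ : ℕ) : Decidable (ColSupp j₀ κ) := by unfold ColSupp; infer_instance

/-- The first forms of a represented computation at matrix units are the pattern bits. -/
theorem ofNil_f_single {N : ℕ} {β : BilinComp (psiK 3 3 3 []) (Fin N)} {P : Fin N → ℕ}
    (hβ : Represents β P) (ρ : Fin N) (b : Fin 3 × Fin 3) :
    (ofNil β).f ρ (Matrix.single b.1 b.2 1) = if (P ρ).testBit (pos 3 b.1 b.2) then 1 else 0 := by
  rw [ofNil_f, hβ ρ, ← form_single]
  rfl

/-- **HK7, rows**: a realizable 21-profile has at most 4 patterns (with multiplicity) supported in any one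
coordinate row. -/
theorem card_rowSupp_le_four {P : Fin 21 → ℕ} (h : Realizable21 P) (i₀ : Fin 3) :
    (Finset.univ.filter fun i => RowSupp i₀ (P i)).card ≤ 4 := by
  classical
  obtain ⟨β, hβ⟩ := h
  have ht := matMulTensor_eq_sum_triad (ofNil β)
  have hD : ∀ ρ ∈ (Finset.univ.filter fun i => RowSupp i₀ (P i)), ∀ b : Fin 3 × Fin 3, b.1 ≠ i₀ →
      (fun b : Fin 3 × Fin 3 => (ofNil β).f ρ (Matrix.single b.1 b.2 1)) b = 0 := by
    intro ρ hρ b hb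
    have hs := (Finset.mem_filter.1 hρ).2 b hb
    show (ofNil β).f ρ (Matrix.single b.1 b.2 1) = 0
    rw [ofNil_f_single hβ, hs]
    rfl
  have h7 := HopcroftKerrRow.hopcroftKerr1971_lemma7_row (K := ZMod 2) (m := 2) (p := 3) (n := 3) (by norm_num) ht i₀ _ hD
  have h15 := Cert233.le_tensorRank_matMulTensor_233_gf2
  simp only [Fintype.card_fin] at h7
  omega

/-- **HK7, columns**: at most 4 patterns supported in any one coordinate column. -/
theorem card_colSupp_le_four {P : Fin 21 → ℕ} (h : Realizable21 P) (j₀ : Fin 3) :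
    (Finset.univ.filter fun i => ColSupp j₀ (P i)).card ≤ 4 := by
  classical
  obtain ⟨β, hβ⟩ := h
  have ht := matMulTensor_eq_sum_triad (ofNil β)
  have hD : ∀ ρ ∈ (Finset.univ.filter fun i => ColSupp j₀ (P i)), ∀ b : Fin 3 × Fin 3, b.2 ≠ j₀ →
      (fun b : Fin 3 × Fin 3 => (ofNil β).f ρ (Matrix.single b.1 b.2 1)) b = 0 := by
    intro ρ hρ b hb
    have hs := (Finset.mem_filter.1 hρ).2 b hb
    show (ofNil β).f ρ (Matrix.single b.1 b.2 1) = 0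
    rw [ofNil_f_single hβ, hs]
    rfl
  have h7 := HopcroftKerrRow.hopcroftKerr1971_lemma7_col (K := ZMod 2) (k := 3) (m := 2) (n := 3) (by norm_num) ht j₀ _ hD
  have h15 := Cert233.le_tensorRank_matMulTensor_233_gf2
  simp only [Fintype.card_fin] at h7
  omega

/-- **HK7-violation in coordinates**: some coordinate row or column of the `3 × 3` layout carries `≥ 5` of the
21 patterns (with multiplicity). Decidable (kernel `decide` per class). -/
def HK7Violating (P : Fin 21 → ℕ) : Prop :=
  (∃ i₀ : Fin 3, 5 ≤ (Finset.univ.filter fun i => RowSupp i₀ (P i)).card) ∨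
  (∃ j₀ : Fin 3, 5 ≤ (Finset.univ.filter fun i => ColSupp j₀ (P i)).card)

/-- `HK7Violating` is decidable (kernel `decide` per census class). -/
instance (P : Fin 21 → ℕ) : Decidable (HK7Violating P) := by unfold HK7Violating; infer_instance

/-- **An HK7-violating profile is unrealizable** (kernel: HK71 Lemma 7 + `R_𝔽₂(⟨2,3,3⟩) = 15`). -/
theorem not_realizable21_of_hk7 {P : Fin 21 → ℕ} (h : HK7Violating P) : ¬ Realizable21 P := by
  intro hP
  rcases h with ⟨i₀, hi⟩ | ⟨j₀, hj⟩
  · have := card_rowSupp_le_four hP i₀; omega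
  · have := card_colSupp_le_four hP j₀; omega

/-- **… and so is every class that Wang's group carries onto one** (any grid row/column, not only coordinate
ones): the discharge of record for HK7-violating census classes, with the `GEquiv` chain as the witness. -/
theorem not_realizable21_of_gEquiv_hk7 {Q P : Fin 21 → ℕ} (hG : GEquiv 3 21 Q P) (h : HK7Violating P) :
    ¬ Realizable21 Q :=
  fun hQ => not_realizable21_of_hk7 h (realizable_of_gEquiv hG hQ)

/-- **`R_𝔽₂(⟨3,3,3⟩) ≥ 22` FROM AN HK7-LEGAL CENSUS** (the census of record since lead g5 08:35:33Z enumerates only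
HK7-legal classes): every valid 21-profile is EITHER carried by a `GEquiv` chain onto a coordinate HK7 violation
(discharged here by `not_realizable21_of_gEquiv_hk7`) OR `GEquiv`-related to a listed class, and every listed class is
unrealizable. No row of the table needs to encode HK7 (in particular no false `Cert` for orbit 410 is involved). -/
theorem rankGe22_of_legal_census (rows : List (List ℕ × ℕ)) (hrows : ∀ r ∈ rows, Cert 3 3 3 r.1 r.2)
    (L : List (Fin 21 → ℕ))
    (hcomplete : ∀ P, Valid21 rows P →
      (∃ P', GEquiv 3 21 P P' ∧ HK7Violating P') ∨ (∃ Q ∈ L, GEquiv 3 21 P Q))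
    (hnone : ∀ Q ∈ L, ¬ Realizable21 Q) :
    22 ≤ tensorRank (matMulTensor (ZMod 2) 3 3 3) :=
  rankGe22_of_unrealizable rows hrows fun P hP hreal => by
    rcases hcomplete P hP with ⟨P', hG, h7⟩ | ⟨Q, hQ, hG⟩
    · exact not_realizable21_of_gEquiv_hk7 hG h7 hreal
    · exact hnone Q hQ (realizable_of_gEquiv hG hreal)

/-- Kernel self-test of the decidable predicate: 21 copies of the pattern `E₀₀` violate HK7 (row 0). -/
example : HK7Violating (fun _ => 1) := by decide

end HK7

end Summit.Ventures.MM22.Census22
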